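import Summits.KontsevichZagierPeriods.KontsevichZagierPeriods.Theorems.TerasomaMultiplicationBetaCancellationStubTameFormAux14
import Summits.KontsevichZagierPeriods.KontsevichZagierPeriods.Theorems.TerasomaMultiplicationBetaCancellationStubTameFormAux17

/-!
# `BetaCancellation` (stmt-KontsevichZagierPeriods-13633), line `divisor-slicing-transshipment` — stub `stub_tameForm`, auxiliary file 18: the normal form at the working level

From a vanishing shadow of `[K × r] − [K × r']` (`K` the Cauchy line) with `K × r ≠ K × r'`:
extract the normal form with common spectator (auxiliary file 14), stabilise it to the working
level `1 + (D + 3)` (`MIso.restab`), and rewrite the four main slots as catalytic cylinders over the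
stabilised parts of `r`, `r'` (auxiliary file 16) and the spectator slots as thrice-stabilised
representations `C k` of dimension `1 + D` with positive integrands (auxiliary file 17).

References: crux NOTES c6 (F13); M. Kontsevich, D. Zagier, *Periods* (2001), §1.2.
-/

noncomputable section

-- `Summit.KontsevichZagierPeriods.KontsevichZagierPeriods.…` is the tree's mandated layout (single-conjunct summit).
set_option linter.dupNamespace false

namespace Summit.KontsevichZagierPeriods.KontsevichZagierPeriods.BetaCancellationDivisorSlicing

open MeasureTheory Set Function
open Literature.NumberTheory.Transcendental
open Literature.NumberTheory.Transcendental.KZ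
open Literature.ModelTheory.ExponentialFields (IsSemialgebraic isSemialgebraic_univ)

variable {n m : ℕ} (K : IntegralRep 1) (hKd : K.domain = Set.univ)
  (hKi : Set.EqOn K.integrand (fun x => 1 / (1 + x 0 ^ 2)) K.domain)

/-- Thrice-stabilised spectator representations: for a family `t` of representations of dimensions
`≤ M` there are representations of dimension `M` realising the lifted positive parts and the lifted
sign-flipped negative parts, all with positive integrands. [folklore] -/
theorem exists_specReps {s M : ℕ} (t : Fin s → Σ k, IntegralRep k) (ht : ∀ i, (t i).1 ≤ M) :
    ∃ C : Fin s ⊕ Fin s → IntegralRep M,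
      (∀ k, ∀ x ∈ (C k).domain, 0 < (C k).integrand x) ∧
      (∀ i, (C (Sum.inl i)).domain = liftSet M (posSet (t i).2) ∧
        (C (Sum.inl i)).integrand = liftFun M (t i).2.integrand) ∧
      (∀ i, (C (Sum.inr i)).domain = liftSet M (negSet (t i).2) ∧
        (C (Sum.inr i)).integrand = liftFun M (-(t i).2.integrand)) := by
  have hp : ∀ i, ∃ Cp : IntegralRep M, Cp.domain = liftSet M (posSet (t i).2) ∧
      Cp.integrand = liftFun M (t i).2.integrand := fun i => by
    obtain ⟨P, hPd, hPi⟩ := exists_posRep (t i).2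
    obtain ⟨Cp, hd, hi, -⟩ := exists_stabRep P (ht i)
    exact ⟨Cp, by rw [hd, hPd, liftSet_eq], by rw [hi, hPi, liftFun_eq]⟩
  have hn : ∀ i, ∃ Cn : IntegralRep M, Cn.domain = liftSet M (negSet (t i).2) ∧
      Cn.integrand = liftFun M (-(t i).2.integrand) := fun i => by
    obtain ⟨P, hPd, hPi⟩ := exists_negRep (t i).2
    obtain ⟨Cn, hd, hi, -⟩ := exists_stabRep P (ht i)
    exact ⟨Cn, by rw [hd, hPd, liftSet_eq], by rw [hi, hPi, liftFun_eq]⟩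
  choose Cp hCpd hCpi using hp
  choose Cn hCnd hCni using hn
  refine ⟨Sum.elim Cp Cn, ?_, fun i => ⟨hCpd i, hCpi i⟩, fun i => ⟨hCnd i, hCni i⟩⟩
  rintro (i | i) x hx
  · simp only [Sum.elim_inl, hCpi, hCpd] at hx ⊢
    exact liftFun_pos_of_mem_liftSet_posSet (ht i) _ hx
  · simp only [Sum.elim_inr, hCni, hCnd] at hx ⊢
    exact liftFun_neg_pos_of_mem_liftSet_negSet (ht i) _ hx

include hKd hKi in
/-- **The normal form at the working level `1 + (D + 3)`**: main slots as catalytic cylinders over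
the stabilised parts of `r`, `r'`, spectator slots as thrice-stabilised representations `C k` with
positive integrands. [folklore] -/
theorem exists_levelMIso (r : IntegralRep n) (r' : IntegralRep m)
    (S : Shadow (of (K.prod r) - of (K.prod r')))
    (hXY : (⟨1 + n, K.prod r⟩ : Σ k, IntegralRep k) ≠ ⟨1 + m, K.prod r'⟩) :
    ∃ (D : ℕ) (hn : n ≤ D + 3) (hm : m ≤ D + 3) (_ : n ≤ D + 2) (_ : m ≤ D + 2)
      (h₂ : 1 + D ≤ 1 + (D + 3)) (s : ℕ)
      (C : Fin s ⊕ Fin s → IntegralRep (1 + D)),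
      (∀ k, ∀ x ∈ (C k).domain, 0 < (C k).integrand x) ∧
      Nonempty (MIso (1 + (D + 3))
        (Sum.elim (fun _ : Unit => {w : Fin (1 + (D + 3)) → ℝ |
            (fun i : Fin (D + 3) => w (Fin.natAdd 1 i)) ∈ stabSet hn (posSet r)})
          (Sum.elim (fun _ : Unit => {w : Fin (1 + (D + 3)) → ℝ |
            (fun i : Fin (D + 3) => w (Fin.natAdd 1 i)) ∈ stabSet hm (negSet r')})
            (fun k => stabSet h₂ (C k).domain)))
        (Sum.elim (fun _ w => 1 / (1 + w (Fin.castAdd (D + 3) 0) ^ 2) *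
            stabFun hn r.integrand (fun i : Fin (D + 3) => w (Fin.natAdd 1 i)))
          (Sum.elim (fun _ w => 1 / (1 + w (Fin.castAdd (D + 3) 0) ^ 2) *
            stabFun hm (-r'.integrand) (fun i : Fin (D + 3) => w (Fin.natAdd 1 i)))
            (fun k => stabFun h₂ (C k).integrand)))
        (Sum.elim (fun _ : Unit => {w : Fin (1 + (D + 3)) → ℝ |
            (fun i : Fin (D + 3) => w (Fin.natAdd 1 i)) ∈ stabSet hm (posSet r')})
          (Sum.elim (fun _ : Unit => {w : Fin (1 + (D + 3)) → ℝ |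
            (fun i : Fin (D + 3) => w (Fin.natAdd 1 i)) ∈ stabSet hn (negSet r)})
            (fun k => stabSet h₂ (C k).domain)))
        (Sum.elim (fun _ w => 1 / (1 + w (Fin.castAdd (D + 3) 0) ^ 2) *
            stabFun hm r'.integrand (fun i : Fin (D + 3) => w (Fin.natAdd 1 i)))
          (Sum.elim (fun _ w => 1 / (1 + w (Fin.castAdd (D + 3) 0) ^ 2) *
            stabFun hn (-r.integrand) (fun i : Fin (D + 3) => w (Fin.natAdd 1 i)))
            (fun k => stabFun h₂ (C k).integrand)))) := by
  obtain ⟨s, t, N, hX, hY, ht, ⟨m₀⟩⟩ := S.extract _ _ hXY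
  have h₁ : N ≤ 1 + N := by omega
  have h₂ : 1 + N ≤ 1 + (N + 3) := by omega
  have hn : n ≤ N + 3 := by omega
  have hm : m ≤ N + 3 := by omega
  have hn2 : n ≤ N + 2 := by omega
  have hm2 : m ≤ N + 2 := by omega
  have hX' : 1 + n ≤ 1 + (N + 3) := by omega
  have hY' : 1 + m ≤ 1 + (N + 3) := by omega
  obtain ⟨m₁⟩ := m₀.restab h₁
  obtain ⟨m₂⟩ := m₁.restab h₂
  obtain ⟨C, hCpos, hCp, hCn⟩ := exists_specReps (M := 1 + N) t (fun i => (ht i).trans h₁)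
  refine ⟨N, hn, hm, hn2, hm2, h₂, s, C, hCpos, m₂.copy ?_ ?_ ?_ ?_⟩
  · funext x
    rcases x with _ | _ | k | k
    · simp only [Sum.elim_inl, stabSet_stabSet]
      exact (stabSet_posSet_prod K hKd hKi r hX' hn).symm
    · simp only [Sum.elim_inr, Sum.elim_inl, stabSet_stabSet]
      exact (stabSet_negSet_prod K hKd hKi r' hY' hm).symm
    · simp only [Sum.elim_inr, Sum.elim_inl, (hCp k).1, stabSet_liftSet (ht k) h₁]
    · simp only [Sum.elim_inr, (hCn k).1, stabSet_liftSet (ht k) h₁]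
  · funext x
    rcases x with _ | _ | k | k
    · simp only [Sum.elim_inl, stabFun_stabFun]
      exact (stabFun_prod K hKd hKi r hX' hn).symm
    · simp only [Sum.elim_inr, Sum.elim_inl, stabFun_stabFun]
      exact (stabFun_neg_prod K hKd hKi r' hY' hm).symm
    · simp only [Sum.elim_inr, Sum.elim_inl, (hCp k).2, stabFun_liftFun (ht k) h₁]
    · simp only [Sum.elim_inr, (hCn k).2, stabFun_liftFun (ht k) h₁]
  · funext x
    rcases x with _ | _ | k | k
    · simp only [Sum.elim_inl, stabSet_stabSet]
      exact (stabSet_posSet_prod K hKd hKi r' hY' hm).symm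
    · simp only [Sum.elim_inr, Sum.elim_inl, stabSet_stabSet]
      exact (stabSet_negSet_prod K hKd hKi r hX' hn).symm
    · simp only [Sum.elim_inr, Sum.elim_inl, (hCp k).1, stabSet_liftSet (ht k) h₁]
    · simp only [Sum.elim_inr, (hCn k).1, stabSet_liftSet (ht k) h₁]
  · funext x
    rcases x with _ | _ | k | k
    · simp only [Sum.elim_inl, stabFun_stabFun]
      exact (stabFun_prod K hKd hKi r' hY' hm).symm
    · simp only [Sum.elim_inr, Sum.elim_inl, stabFun_stabFun]
      exact (stabFun_neg_prod K hKd hKi r hX' hn).symm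
    · simp only [Sum.elim_inr, Sum.elim_inl, (hCp k).2, stabFun_liftFun (ht k) h₁]
    · simp only [Sum.elim_inr, (hCn k).2, stabFun_liftFun (ht k) h₁]

/-! ### Headline -/

/-- Registered helper goal of the stub `stub_tameForm`: thrice-stabilised spectator representations
with positive integrands. [folklore] -/
theorem tameForm_aux_specReps : ∀ {s M : ℕ} (t : Fin s → Σ k, IntegralRep k), (∀ i, (t i).1 ≤ M) → ∃ C : Fin s ⊕ Fin s → IntegralRep M, (∀ k, ∀ x ∈ (C k).domain, 0 < (C k).integrand x) ∧ (∀ i, (C (Sum.inl i)).domain = liftSet M (posSet (t i).2) ∧ (C (Sum.inl i)).integrand = liftFun M (t i).2.integrand) ∧ (∀ i, (C (Sum.inr i)).domain = liftSet M (negSet (t i).2) ∧ (C (Sum.inr i)).integrand = liftFun M (-(t i).2.integrand)) :=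
  fun t ht => exists_specReps t ht

end Summit.KontsevichZagierPeriods.KontsevichZagierPeriods.BetaCancellationDivisorSlicing

end
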